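import Summits.PneNP.PneNP.Theorems.SmallBlockRothvossBallGridBound
import Mathlib.Analysis.SpecialFunctions.Pow.Asymptotics
import HarnessLib

/-!
# Block psd lifts of the perfect matching polytope: sublinear blocks (cell pnp-psdrank, rung F-N2.SOC)

Landing file 4 (pnp-psdrank-eng g4; work file HOME/pnp-psdrank-eng/lean/BlockLift.lean v3). The stretched-exponential
reading of `blockPsd_largeBlocks`: `blockPsd_sublinearBlocks` — there is `c > 0` (`c = δ_R/1596`) such that for
every `ε > 0` and all even `n ≥ n₀(ε)`, every `(S^b_+)^m` psd lift of `P_PM(n)` with `b + 1 ≤ n^{1−ε}` has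
`m ≥ 2^{c n^ε}`. (Blocks of dimension `n^{1−ε}` still force stretched-exponentially many blocks; at `ε = 1`,
i.e. bounded `b`, this is the exponential fixed-block rung up to constants.) [cite: Rothvoss2017, Thm. 1]
WHAT THIS IS NOT: not a bound on general psd rank / SDP extension complexity of matching (rung F-N2 stays open);
nothing P ≠ NP-relevant; `n₀(ε)` is ineffective here (extracted from `log x = o(x^ε)`).
-/

set_option linter.dupNamespace false -- `Summit.PneNP.PneNP.…`: summit = sub-problem (D-0017)

noncomputable section

open Finset Real Literature.Barriers.PneNP Literature.Combinatorics.Optimization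

namespace Summit.PneNP.PneNP.Theorems.SmallBlockRothvossBallGrid

/-- Polynomial versus stretched exponential: for `κ, ε > 0`, eventually `n⁹ ≤ 2^{κ n^ε}`
(from `log x = o(x^ε)`). -/
theorem eventually_pow_nine_le_two_rpow {κ ε : ℝ} (hκ : 0 < κ) (hε : 0 < ε) :
    ∃ n₁ : ℕ, ∀ n : ℕ, n₁ ≤ n → (n : ℝ) ^ 9 ≤ (2 : ℝ) ^ (κ * (n : ℝ) ^ ε) := by
  have hlog2 : 0 < Real.log 2 := Real.log_pos one_lt_two
  have hk : 0 < κ * Real.log 2 / 9 := by positivity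
  have ho := (isLittleO_log_rpow_atTop hε).def hk
  have hev : ∀ᶠ x : ℝ in Filter.atTop, x ^ 9 ≤ (2 : ℝ) ^ (κ * x ^ ε) := by
    filter_upwards [ho, Filter.eventually_ge_atTop (1 : ℝ)] with x hx hx1
    have hx0 : 0 < x := by linarith
    rw [Real.norm_of_nonneg (Real.log_nonneg hx1), Real.norm_of_nonneg (Real.rpow_nonneg hx0.le _)] at hx
    have h1 : Real.log x * 9 ≤ Real.log 2 * (κ * x ^ ε) := by nlinarith
    calc x ^ 9 = x ^ ((9 : ℕ) : ℝ) := (Real.rpow_natCast x 9).symm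
      _ = Real.exp (Real.log x * 9) := by rw [Real.rpow_def_of_pos hx0]; norm_num
      _ ≤ Real.exp (Real.log 2 * (κ * x ^ ε)) := Real.exp_le_exp.2 h1
      _ = (2 : ℝ) ^ (κ * x ^ ε) := by rw [Real.rpow_def_of_pos two_pos]
  obtain ⟨X, hX⟩ := Filter.eventually_atTop.1 hev
  refine ⟨⌈X⌉₊, fun n hn => ?_⟩
  have hXn : X ≤ (n : ℝ) := (Nat.le_ceil X).trans (by exact_mod_cast hn)
  exact hX n hXn

/-- **Sublinear blocks.** There is `c > 0` (`c = δ_R/1596`) such that for every `ε > 0` and all even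
`n ≥ n₀(ε)`: every `(S^b_+)^m` psd lift of `P_PM(n)` all of whose blocks have dimension `b` with
`b + 1 ≤ n^{1−ε}` has `m ≥ 2^{c n^ε}` blocks. -/
theorem blockPsd_sublinearBlocks : ∃ c : ℝ, 0 < c ∧ ∀ ε : ℝ, 0 < ε → ∃ n₀ : ℕ, ∀ n : ℕ, n₀ ≤ n →
    Even n → ∀ b m : ℕ, 1 ≤ b → (b : ℝ) + 1 ≤ (n : ℝ) ^ (1 - ε) → HasBlockPsdFactorization n b m →
      (2 : ℝ) ^ (c * (n : ℝ) ^ ε) ≤ m := by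
  obtain ⟨c₀, hc₀, n₀, hn₀⟩ := blockPsd_largeBlocks
  refine ⟨c₀ / 2, by positivity, fun ε hε => ?_⟩
  obtain ⟨n₁, hn₁⟩ := eventually_pow_nine_le_two_rpow (half_pos hc₀) hε
  refine ⟨max n₀ (max n₁ 1), fun n hn heven b m hb hbn hfac => ?_⟩
  have hnn₀ : n₀ ≤ n := le_trans (le_max_left _ _) hn
  have hnn₁ : n₁ ≤ n := le_trans (le_max_left _ _) (le_trans (le_max_right _ _) hn)
  have hn1 : 1 ≤ n := le_trans (le_max_right _ _) (le_trans (le_max_right _ _) hn)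
  have hnR : (1 : ℝ) ≤ n := by exact_mod_cast hn1
  have hnpos : (0 : ℝ) < n := by linarith
  -- `b ≤ n`
  have hpow_le : (n : ℝ) ^ (1 - ε) ≤ n := by
    calc (n : ℝ) ^ (1 - ε) ≤ (n : ℝ) ^ (1 : ℝ) := Real.rpow_le_rpow_of_exponent_le hnR (by linarith)
      _ = n := Real.rpow_one _
  have hbn' : b ≤ n := by
    have h : (b : ℝ) ≤ n := by linarith [hbn.trans hpow_le]
    exact_mod_cast h
  have h1 := hn₀ n hnn₀ heven b m hb hbn' hfac
  -- `n^ε ≤ n/(b+1)`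
  have hb1 : (0 : ℝ) < (b : ℝ) + 1 := by positivity
  have hε1 : (n : ℝ) ^ ε ≤ n / ((b : ℝ) + 1) := by
    rw [le_div_iff₀ hb1]
    calc (n : ℝ) ^ ε * ((b : ℝ) + 1) ≤ (n : ℝ) ^ ε * (n : ℝ) ^ (1 - ε) :=
          mul_le_mul_of_nonneg_left hbn (Real.rpow_nonneg hnpos.le _)
      _ = n := by
          rw [← Real.rpow_add hnpos]
          norm_num
  have h2 : (2 : ℝ) ^ (c₀ * (n : ℝ) ^ ε) ≤ (2 : ℝ) ^ (c₀ * n / (b + 1)) := by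
    apply Real.rpow_le_rpow_of_exponent_le (by norm_num)
    rw [mul_div_assoc]
    exact mul_le_mul_of_nonneg_left hε1 hc₀.le
  have h3 := hn₁ n hnn₁
  have hsplit : (2 : ℝ) ^ (c₀ * (n : ℝ) ^ ε) =
      (2 : ℝ) ^ (c₀ / 2 * (n : ℝ) ^ ε) * (2 : ℝ) ^ (c₀ / 2 * (n : ℝ) ^ ε) := by
    rw [← Real.rpow_add two_pos]; ring_nf
  have hy0 : 0 < (2 : ℝ) ^ (c₀ / 2 * (n : ℝ) ^ ε) := Real.rpow_pos_of_pos two_pos _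
  have h4 : (2 : ℝ) ^ (c₀ / 2 * (n : ℝ) ^ ε) * (2 : ℝ) ^ (c₀ / 2 * (n : ℝ) ^ ε) ≤
      m * (2 : ℝ) ^ (c₀ / 2 * (n : ℝ) ^ ε) := by
    calc _ = (2 : ℝ) ^ (c₀ * (n : ℝ) ^ ε) := hsplit.symm
      _ ≤ m * (n : ℝ) ^ 9 := h2.trans h1
      _ ≤ m * (2 : ℝ) ^ (c₀ / 2 * (n : ℝ) ^ ε) := mul_le_mul_of_nonneg_left h3 (Nat.cast_nonneg m)
  exact le_of_mul_le_mul_right h4 hy0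

end Summit.PneNP.PneNP.Theorems.SmallBlockRothvossBallGrid

end
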